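import Summits.HodgeConjecture.HodgeCM.PerL34.FockIrreducible_3

/-! PORT of `HodgeCM/PerL34/FockIrreducible.lean` (HodgeCMPerL run 82) — part 4: continuation of `Summits.HodgeConjecture.HodgeCM.PerL34.FockIrreducible_3` (split at a top-level declaration boundary by port_pkg.py; scope re-opened below; declarations unchanged). -/

-- port_pkg: scope re-opened for this part (file-level context, then the namespace/section stack open at the cut)
set_option autoImplicit false
namespace HodgeCM
namespace PerL34
namespace Fock
open MvPolynomial Finsupp
open scoped BigOperators
section Harmonic
/-- **Adams Thm 6.3 (5)**: the harmonics `𝓗_k` of `F_k` form an IRREDUCIBLE `𝔨′`-module — invariant-subspace form: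
a `𝔨′`-stable subspace containing one non-zero harmonic of `F_k` contains them all. -/
theorem harm_mem_of_isKStable {k : ℤ} (M : Submodule ℂ HarmModel) (hM : IsKStable M) {v : HarmModel}
    (hvM : v ∈ M) (hv : v ≠ 0) (hvk : v ∈ hpiece k) (hvh : IsHarm v) {f : HarmModel} (hfk : f ∈ hpiece k)
    (hfh : IsHarm f) : f ∈ M := by
  obtain ⟨m₀, hm₀⟩ : v.support.Nonempty := by
    rw [Finset.nonempty_iff_ne_empty, Ne, MvPolynomial.support_eq_empty]
    exact hv
  have hm₀M : monomial m₀ (1 : ℂ) ∈ M := monomial_mem_of_eulerStable M hM.euler hvM hm₀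
  have hk₀ := (mem_hpiece_iff k v).mp hvk m₀ hm₀
  have hh₀ := (isHarm_iff_support v).mp hvh m₀ hm₀
  rw [← hexp_eta m₀] at hm₀M
  refine mem_of_monomial_mem M fun m hm => ?_
  have hk := (mem_hpiece_iff k f).mp hfk m hm
  have hh := (isHarm_iff_support f).mp hfh m hm
  rw [← hexp_eta m]
  by_cases hk0 : 0 ≤ k
  · have e₀0 : m₀ (Sum.inr ()) = 0 := by omega
    have e0 : m (Sum.inr ()) = 0 := by omega
    rw [e0]
    rw [e₀0] at hm₀M
    have h1 := reach_collect M (hM.1 0 1) _ _ _ hm₀M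
    have hab : m₀ (Sum.inl 0) + m₀ (Sum.inl 1) = m (Sum.inl 0) + m (Sum.inl 1) := by omega
    rw [hab] at h1
    exact reach_distribute M (hM.1 1 0) _ _ _ h1
  · obtain ⟨h1, h2, h3, h4, h5⟩ : m₀ (Sum.inl 0) = 0 ∧ m₀ (Sum.inl 1) = 0 ∧ m (Sum.inl 0) = 0 ∧
        m (Sum.inl 1) = 0 ∧ m₀ (Sum.inr ()) = m (Sum.inr ()) := by omega
    rw [h3, h4]
    rw [h1, h2, h5] at hm₀M
    exact hm₀M

/-! ### 3.8 `F_k = 𝒰(𝔭′⁺)·𝓗_k` (Howe duality (4)) -/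

/-- **Adams Thm 6.3 (4)**: `F_k` is generated by its harmonics under `𝔭′⁺` alone — a `𝔭′⁺`-stable subspace
containing `𝓗_k` contains `F_k`. -/
theorem hpiece_le_of_pStable_of_harm (k : ℤ) (M : Submodule ℂ HarmModel) (hP' : ∀ a, ∀ f ∈ M, hP a f ∈ M)
    (hharm : ∀ f, f ∈ hpiece k → IsHarm f → f ∈ M) : hpiece k ≤ M := by
  intro f hf
  refine mem_of_monomial_mem M fun m hm => ?_
  have hk := (mem_hpiece_iff k f).mp hf m hm
  rw [← hexp_eta m]
  change hmon (m (Sum.inl 0)) (m (Sum.inl 1)) (m (Sum.inr ())) ∈ M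
  set a := m (Sum.inl 0)
  set b := m (Sum.inl 1)
  set e := m (Sum.inr ())
  by_cases hle : e ≤ a + b
  · obtain ⟨a', b', e₀, e₁, ha, hb, he⟩ :
        ∃ a' b' e₀ e₁ : ℕ, a = a' + e₀ ∧ b = b' + e₁ ∧ e = e₀ + e₁ :=
      ⟨a - min a e, b - (e - min a e), min a e, e - min a e, by omega, by omega, by omega⟩
    have hk' : ((a' : ℤ) + b' - (0 : ℕ)) = k := by push_cast; omega
    have h0 : hmon a' b' 0 ∈ M :=
      hharm _ (by rw [← hk']; exact hmon_mem_hpiece a' b' 0) (isHarm_hmon_zfree a' b')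
    have h1 := reach_raise M (hP' 0) e₀ a' b' 0 h0
    have h2 := reach_raise' M (hP' 1) e₁ _ _ _ h1
    have h3 : hmon a b e = hmon (a' + e₀) (b' + e₁) (0 + e₀ + e₁) := by
      rw [ha, hb, he, zero_add]
    rw [h3]
    exact h2
  · obtain ⟨j, hj⟩ : ∃ j, e = a + b + j := ⟨e - (a + b), by omega⟩
    have hk' : ((0 : ℕ) + ((0 : ℕ) : ℤ) - (j : ℕ)) = k := by push_cast; omega
    have h0 : hmon 0 0 j ∈ M :=
      hharm _ (by rw [← hk']; exact hmon_mem_hpiece 0 0 j) (isHarm_hw_pow j)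
    have h1 := reach_raise M (hP' 0) a 0 0 j h0
    have h2 := reach_raise' M (hP' 1) b _ _ _ h1
    have h3 : hmon a b e = hmon (0 + a) (0 + b) (j + a + b) := by
      rw [zero_add, zero_add, hj]
      congr 1
      omega
    rw [h3]
    exact h2

end Harmonic

/-! ## 4. The pair `(U(1), U(3))`: the definite one-line model `ℂ[z₁, z₂, z₃]` (pv12's `DefModel`, (F4)) -/

section Definite

/-- The polarisations `E_{ab} = z_a ∂_{z_b}` spanning the image of `𝔤′ = 𝔤𝔩₃ = 𝔲(3)_ℂ` on `ℂ[z₁,z₂,z₃]` (pv12 (F4):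
the root operators `a ≠ b`, and the torus `E_{aa} = weightOp (defTorWt a)` up to the vacuum shift `α`). -/
noncomputable def dE (a b : Fin 3) : DefModel →ₗ[ℂ] DefModel where
  toFun f := X a * pderiv b f
  map_add' f g := by simp only [map_add, mul_add]
  map_smul' r f := by simp only [Derivation.map_smul, mul_smul_comm, RingHom.id_apply]

/-- (Ported verbatim from the HodgeCMPerL package; no docstring in the source.) -/
theorem dE_apply (a b : Fin 3) (f : DefModel) : dE a b f = X a * pderiv b f := rfl

/-- pv12's torus operators are the diagonal polarisations. -/
theorem weightOp_defTorWt_eq (a : Fin 3) (f : DefModel) : weightOp (defTorWt a) f = dE a a f := by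
  rw [weightOp_apply, dE_apply, Finset.sum_eq_single a]
  · simp [defTorWt]
  · intro b _ hb
    simp [defTorWt, hb]
  · intro h
    exact absurd (Finset.mem_univ a) h

/-- The `U(1)`-isotypic pieces of `ℂ[z₁,z₂,z₃]` (`z_a ↦ u z_a`): the homogeneous components `Sym^d(V)`. -/
noncomputable abbrev dpiece (d : ℕ) : Submodule ℂ DefModel := wpiece (fun _ => (1 : ℤ)) (d : ℤ)

/-- (Ported verbatim from the HodgeCMPerL package; no docstring in the source.) -/
theorem mem_dpiece_iff_isHomogeneous (d : ℕ) (f : DefModel) :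
    f ∈ dpiece d ↔ MvPolynomial.IsHomogeneous f d :=
  mem_wpiece_one_iff_isHomogeneous d f

/-- (Ported verbatim from the HodgeCMPerL package; no docstring in the source.) -/
theorem dpiece_map_mem (d : ℕ) : ∀ ab : Fin 3 × Fin 3, ∀ f ∈ dpiece d, dE ab.1 ab.2 f ∈ dpiece d := by
  rintro ⟨a, b⟩ f hf
  refine map_mem_wpiece (dE a b) _ _ (fun m hm => ?_) hf
  rw [dE_apply, X_mul_pderiv_monomial']
  by_cases hb : m b = 0
  · rw [hb, Nat.cast_zero, zero_smul]
    exact Submodule.zero_mem _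
  · refine Submodule.smul_mem _ _ (monomial_mem_wpiece ?_ _)
    rw [wt_add, wt_single, wt_tsub_single _ hb, hm]
    ring

/-- **Howe duality for `(U(1), U(3))`** (Adams Thm 6.3 (1) in the definite case, where `𝔭′ = 0` and every vector
is harmonic): each `U(1)`-isotypic piece `Sym^d(ℂ³)` of `ℂ[z₁,z₂,z₃]` is `𝔤𝔩₃`-IRREDUCIBLE. -/
theorem dpiece_le_of_stable (d : ℕ) (M : Submodule ℂ DefModel) (hM : ∀ a b, ∀ f ∈ M, dE a b f ∈ M)
    {v : DefModel} (hvM : v ∈ M) (hv : v ≠ 0) (hvd : v ∈ dpiece d) : dpiece d ≤ M :=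
  wpiece_one_le_of_stable M hM hvM hv hvd

/-- (Ported verbatim from the HodgeCMPerL package; no docstring in the source.) -/
theorem dpiece_isGeneratedBy (d : ℕ) {v : DefModel} (hvd : v ∈ dpiece d) (hv : v ≠ 0) :
    IsGeneratedBy (fun ab : Fin 3 × Fin 3 => (dE ab.1 ab.2).restrict (dpiece_map_mem d ab)) (⟨v, hvd⟩ : ↥(dpiece d)) :=
  isGeneratedBy_restrict (dpiece d) (fun ab : Fin 3 × Fin 3 => dE ab.1 ab.2) (dpiece_map_mem d) hvd
    fun S hvS hS => dpiece_le_of_stable d S (fun a b => hS (a, b)) hvS hv hvd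

/-- Link with pv12 (F4) (`isTwistedInvariant_iff`, `trivialType_occurs_iff`): the trivial `U(1)`-type `d = 0` is the
vacuum line of constants. -/
theorem mem_dpiece_zero_iff (f : DefModel) : f ∈ dpiece 0 ↔ ∃ c : ℂ, f = C c := by
  rw [mem_wpiece_iff_support]
  constructor
  · intro h
    refine ⟨coeff 0 f, eq_C_of_support_subset_zero fun m hm => ?_⟩
    have h1 := h m hm
    rw [wt_one] at h1
    have h2 : m.degree = 0 := by exact_mod_cast h1
    exact (Finsupp.degree_eq_zero_iff m).mp h2
  · rintro ⟨c, rfl⟩ m hm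
    classical
    rw [support_C] at hm
    split_ifs at hm with hc
    · simp at hm
    · rw [Finset.mem_singleton] at hm
      rw [hm, wt_one, map_zero, Nat.cast_zero]

end Definite

end Fock

end PerL34

end HodgeCM
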